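import Literature.Barriers.CriticalPhenomena.LaceExpansionXSpaceKernelNorms
import HarnessLib

/-!
# Kernels on pairs: row/column sums, the "head" and "tail" sums of a kernel with one loose
# coordinate, the Cauchy–Schwarz bound for a middle factor, transposition — PROVED (generic)

Barrier catalogue `Literature/Barriers/CriticalPhenomena/` (D-0021), infrastructure for Hara's
two-long-lines estimate `Hara2008_twoLongLinesDiagramBoundPc` (`LaceExpansionXSpaceLemma15Diagrams.lean`,
Hara 2008, §3.5), continuing the generic pair-kernel algebra of
`LaceExpansionXSpaceKernelNorms.lean` (all kernels `X : α × α → α × α → [0, ∞]`).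

After the two long lines of a Hara–Slade diagram are erased (Hara: "The effect of extracting
these `G`'s is nothing but erasing these two lines in the diagram"), the diagram factors as
`Σ_{p,q} L(p) 𝔐(p,q) R(q)` with a left mass `Σ L`, a right mass `Σ R` and a MIDDLE FACTOR
`𝔐(p,q) = Σ_{P,Q} F(p,P) U(P,Q) G(Q,q)` between the two cuts, which has to be bounded uniformly in
its external pairs `p, q` ("the component in the middle which is hard to deal with", §3.5, Case 2).
Its entry `F` is a single two-point function landing on ONE coordinate of the first pair `P` of
`U` (the other coordinate is a loose end of the erased line), and symmetrically for the exit `G`.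
This file proves the generic estimate used for it:

* `pkRow X p = Σ_q X(p,q)`, `pkCol X q = Σ_p X(p,q)` and their propagation
  (`pkRow_pkMul_le : row(XY)(p) ≤ row(X)(p) ‖Y‖_{∞→∞}`, `pkCol_pkMul_le`);
* the HEAD sums `pkHead1 X = sup_a Σ_b row(X)(a,b)` (entered on coordinate 1, coordinate 2 loose),
  `pkHead2`, and the TAIL sums `pkTail1 X = sup_a Σ_b col(X)(a,b)`, `pkTail2`, with
  `pkHead_i (XY) ≤ pkHead_i X · ‖Y‖_{∞→∞}`, `pkTail_i (XY) ≤ ‖X‖_{1→1} · pkTail_i Y`, subadditivity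
  and monotonicity;
* the CAUCHY–SCHWARZ bound with the kernel as weight (`tsum_mul_mul_sq_le`):
  `(Σ_{P,Q} F(P) U(P,Q) G(Q))² ≤ (Σ_P F(P)² row(U)(P)) · (Σ_Q col(U)(Q) G(Q)²)`, and its
  consequence `middle_sq_le_head1_tail1` (& variants): if `F(P) ≤ f(P.1)·c` and `G(Q) ≤ g(Q.1)·c'`
  then `(Σ F U G)² ≤ (c² Σf²) · pkHead1 U · ((c'² Σg²) · pkTail1 U)`;
* the three-factor estimate with a `sup`-bounded middle kernel (`tsum_tsum_mul_mul_le_of_le`,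
  `tsum_pkChainL_middle_le`), the plain `ℓ¹` bound for right chains (`tsum_pkChainR_le`);
* transposition `pkT` and coordinate swap `pkSw` (tails are heads of the transpose; all norms are
  swap-invariant), scaled kernels `pkScaleL`/`pkScaleR` (a rung `ρ` attached to a kernel) and
  monotonicity of all constructions in the kernels.

Everything is over `[0, ∞]` (unconditional sums, free interchanges); no hypothesis on `α` beyond
what each statement names. (The `[0, ∞]` helper lemmas are deliberately NOT placed in a sub-namespace
`….ENNReal`: a namespace `Literature.Barriers.CriticalPhenomena.ENNReal` would capture
`open scoped ENNReal` in every later file of this namespace.)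

## References

* T. Hara, Ann. Probab. 36 (2008) 530–593 (arXiv:math-ph/0504021): §3.5, Case 2 ("we decompose
  into the component in the middle which is hard to deal with, and the left and the right
  components"; "(d-1) is bounded by the Schwarz inequality").
* M. Heydenreich, R. van der Hofstad, *Progress in High-Dimensional Percolation and Random
  Graphs*, Springer 2017: §7.5 ((7.5.11)–(7.5.12), (7.5.20)–(7.5.21)).
-/

noncomputable section

namespace Literature.Barriers.CriticalPhenomena

open scoped ENNReal

variable {α : Type*}

/-! ### An elementary Cauchy–Schwarz inequality in `[0, ∞]` -/

/-- `2xy ≤ x² + y²` in `[0, ∞]` (a private copy of a folklore helper). [folklore] -/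
private theorem ennreal_two_mul_mul_le_sq_add_sq (x y : ℝ≥0∞) : 2 * x * y ≤ x ^ 2 + y ^ 2 := by
  rcases eq_or_ne x ⊤ with rfl | hx
  · rw [ENNReal.top_pow two_ne_zero, top_add]; exact le_top
  rcases eq_or_ne y ⊤ with rfl | hy
  · rw [ENNReal.top_pow two_ne_zero, add_top]; exact le_top
  lift x to NNReal using hx
  lift y to NNReal using hy
  have h : (2 : NNReal) * x * y ≤ x ^ 2 + y ^ 2 := by
    have h2 : ((2 : NNReal) * x * y : ℝ) ≤ ((x ^ 2 + y ^ 2 : NNReal) : ℝ) := by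
      push_cast
      nlinarith [sq_nonneg ((x : ℝ) - y)]
    exact_mod_cast h2
  exact_mod_cast h

/-- **Cauchy–Schwarz for unconditional sums in `[0, ∞]`**: `(Σ_i f_i g_i)² ≤ (Σ_i f_i²)(Σ_i g_i²)`.
[folklore] -/
theorem ennreal_sq_tsum_mul_le {ι : Type*} (f g : ι → ℝ≥0∞) :
    (∑' i, f i * g i) ^ 2 ≤ (∑' i, f i ^ 2) * ∑' i, g i ^ 2 := by
  have key : 2 * (∑' i, f i * g i) ^ 2 ≤ 2 * ((∑' i, f i ^ 2) * ∑' i, g i ^ 2) := by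
    calc 2 * (∑' i, f i * g i) ^ 2 = 2 * ((∑' i, f i * g i) * ∑' j, f j * g j) := by rw [sq]
      _ = 2 * ∑' i, ∑' j, f i * g i * (f j * g j) := by
          rw [← ENNReal.tsum_mul_right]
          congr 1
          exact tsum_congr fun i => ENNReal.tsum_mul_left.symm
      _ = ∑' i, ∑' j, 2 * (f i * g j) * (f j * g i) := by
          rw [← ENNReal.tsum_mul_left]
          refine tsum_congr fun i => ?_
          rw [← ENNReal.tsum_mul_left]
          exact tsum_congr fun j => by ring
      _ ≤ ∑' i, ∑' j, ((f i * g j) ^ 2 + (f j * g i) ^ 2) :=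
          ENNReal.tsum_le_tsum fun i => ENNReal.tsum_le_tsum fun j =>
            ennreal_two_mul_mul_le_sq_add_sq _ _
      _ = (∑' i, ∑' j, f i ^ 2 * g j ^ 2) + ∑' i, ∑' j, f j ^ 2 * g i ^ 2 := by
          rw [← ENNReal.tsum_add]
          refine tsum_congr fun i => ?_
          rw [← ENNReal.tsum_add]
          exact tsum_congr fun j => by ring
      _ = (∑' i, ∑' j, f i ^ 2 * g j ^ 2) + ∑' j, ∑' i, f j ^ 2 * g i ^ 2 := by
          rw [ENNReal.tsum_comm (f := fun i j => f j ^ 2 * g i ^ 2)]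
      _ = 2 * ((∑' i, f i ^ 2) * ∑' i, g i ^ 2) := by
          rw [two_mul]
          congr 1 <;>
          · rw [← ENNReal.tsum_mul_right]
            exact tsum_congr fun i => ENNReal.tsum_mul_left
  exact (ENNReal.mul_le_mul_iff_right two_ne_zero ENNReal.ofNat_ne_top).1 key

/-- From `a² ≤ b` conclude `a ≤ b^{1/2}` in `[0, ∞]`. [folklore] -/
theorem ennreal_le_rpow_half_of_sq_le {a b : ℝ≥0∞} (h : a ^ 2 ≤ b) : a ≤ b ^ (2⁻¹ : ℝ) := by
  rw [ENNReal.le_rpow_inv_iff two_pos]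
  have : a ^ (2 : ℝ) = a ^ 2 := by
    rw [show (2 : ℝ) = ((2 : ℕ) : ℝ) by norm_num, ENNReal.rpow_natCast]
  rwa [this]

/-! ### Row sums and column sums of a kernel -/

/-- Row sum `row(X)(p) = Σ_q X(p, q)` (the action `X𝟙` on the constant function). [folklore] -/
def pkRow (X : α × α → α × α → ℝ≥0∞) (p : α × α) : ℝ≥0∞ := ∑' q, X p q

/-- Column sum `col(X)(q) = Σ_p X(p, q)` (the action `𝟙X`). [folklore] -/
def pkCol (X : α × α → α × α → ℝ≥0∞) (q : α × α) : ℝ≥0∞ := ∑' p, X p q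

/-- `row(X)(p) ≤ ‖X‖_{∞→∞}`. [folklore] -/
theorem pkRow_le_pkNormInf (X : α × α → α × α → ℝ≥0∞) (p : α × α) : pkRow X p ≤ pkNormInf X :=
  tsum_le_pkNormInf X p

/-- `col(X)(q) ≤ ‖X‖_{1→1}`. [folklore] -/
theorem pkCol_le_pkNormOne (X : α × α → α × α → ℝ≥0∞) (q : α × α) : pkCol X q ≤ pkNormOne X :=
  tsum_le_pkNormOne X q

/-- `‖X‖_{∞→∞} = sup_p row(X)(p)`. [folklore] -/
theorem pkNormInf_eq_iSup_pkRow (X : α × α → α × α → ℝ≥0∞) : pkNormInf X = ⨆ p, pkRow X p := rfl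

/-- `‖X‖_{1→1} = sup_q col(X)(q)`. [folklore] -/
theorem pkNormOne_eq_iSup_pkCol (X : α × α → α × α → ℝ≥0∞) : pkNormOne X = ⨆ q, pkCol X q := rfl

/-- **Row sums propagate to the right**: `row(XY)(p) ≤ row(X)(p) · ‖Y‖_{∞→∞}` (pointwise in `p`:
`(XY)𝟙 = X(Y𝟙) ≤ (X𝟙) ‖Y𝟙‖_∞`). [cite: HeydenreichVanDerHofstad2017, (7.5.11)] -/
theorem pkRow_pkMul_le (X Y : α × α → α × α → ℝ≥0∞) (p : α × α) :
    pkRow (pkMul X Y) p ≤ pkRow X p * pkNormInf Y := by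
  calc pkRow (pkMul X Y) p = ∑' p', ∑' q, X p p' * Y p' q := ENNReal.tsum_comm
    _ = ∑' p', X p p' * pkRow Y p' := tsum_congr fun p' => ENNReal.tsum_mul_left
    _ ≤ ∑' p', X p p' * pkNormInf Y :=
        ENNReal.tsum_le_tsum fun p' => mul_le_mul' le_rfl (pkRow_le_pkNormInf Y p')
    _ = pkRow X p * pkNormInf Y := ENNReal.tsum_mul_right

/-- **Column sums propagate to the left**: `col(XY)(q) ≤ ‖X‖_{1→1} · col(Y)(q)`. [folklore] -/
theorem pkCol_pkMul_le (X Y : α × α → α × α → ℝ≥0∞) (q : α × α) :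
    pkCol (pkMul X Y) q ≤ pkNormOne X * pkCol Y q := by
  calc pkCol (pkMul X Y) q = ∑' p, ∑' p', X p p' * Y p' q := rfl
    _ = ∑' p', ∑' p, X p p' * Y p' q := ENNReal.tsum_comm
    _ = ∑' p', pkCol X p' * Y p' q := tsum_congr fun p' => ENNReal.tsum_mul_right
    _ ≤ ∑' p', pkNormOne X * Y p' q :=
        ENNReal.tsum_le_tsum fun p' => mul_le_mul' (pkCol_le_pkNormOne X p') le_rfl
    _ = pkNormOne X * pkCol Y q := ENNReal.tsum_mul_left

/-- Row sums are additive in the kernel. [folklore] -/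
theorem pkRow_add (X Y : α × α → α × α → ℝ≥0∞) (p : α × α) :
    pkRow (fun p q => X p q + Y p q) p = pkRow X p + pkRow Y p :=
  ENNReal.tsum_add

/-- Column sums are additive in the kernel. [folklore] -/
theorem pkCol_add (X Y : α × α → α × α → ℝ≥0∞) (q : α × α) :
    pkCol (fun p q => X p q + Y p q) q = pkCol X q + pkCol Y q :=
  ENNReal.tsum_add

/-- Row sums are monotone in the kernel. [folklore] -/
theorem pkRow_mono {X Y : α × α → α × α → ℝ≥0∞} (h : ∀ p q, X p q ≤ Y p q) (p : α × α) :
    pkRow X p ≤ pkRow Y p :=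
  ENNReal.tsum_le_tsum fun q => h p q

/-- Column sums are monotone in the kernel. [folklore] -/
theorem pkCol_mono {X Y : α × α → α × α → ℝ≥0∞} (h : ∀ p q, X p q ≤ Y p q) (q : α × α) :
    pkCol X q ≤ pkCol Y q :=
  ENNReal.tsum_le_tsum fun p => h p q

/-! ### Head and tail sums: one coordinate of the boundary pair entered, the other loose -/

/-- The **head sum entered on coordinate 1**: `sup_a Σ_b row(X)(a, b)` — the first coordinate of the
input pair is where the entry line lands, the second coordinate is the loose end of the erased line
and is summed together with everything to the right. [cite: Hara2008, §3.5 (Case 2, the middle factor)] -/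
def pkHead1 (X : α × α → α × α → ℝ≥0∞) : ℝ≥0∞ := ⨆ a, ∑' b, pkRow X (a, b)

/-- The **head sum entered on coordinate 2**: `sup_b Σ_a row(X)(a, b)`. [cite: Hara2008, §3.5 (Case 2)] -/
def pkHead2 (X : α × α → α × α → ℝ≥0∞) : ℝ≥0∞ := ⨆ b, ∑' a, pkRow X (a, b)

/-- The **tail sum exited from coordinate 1**: `sup_a Σ_b col(X)(a, b)`. [cite: Hara2008, §3.5 (Case 2)] -/
def pkTail1 (X : α × α → α × α → ℝ≥0∞) : ℝ≥0∞ := ⨆ a, ∑' b, pkCol X (a, b)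

/-- The **tail sum exited from coordinate 2**: `sup_b Σ_a col(X)(a, b)`. [cite: Hara2008, §3.5 (Case 2)] -/
def pkTail2 (X : α × α → α × α → ℝ≥0∞) : ℝ≥0∞ := ⨆ b, ∑' a, pkCol X (a, b)

/-- `Σ_b row(X)(a,b) ≤ pkHead1 X`. [folklore] -/
theorem tsum_pkRow_le_pkHead1 (X : α × α → α × α → ℝ≥0∞) (a : α) :
    ∑' b, pkRow X (a, b) ≤ pkHead1 X :=
  le_iSup (fun a => ∑' b, pkRow X (a, b)) a

/-- `Σ_a row(X)(a,b) ≤ pkHead2 X`. [folklore] -/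
theorem tsum_pkRow_le_pkHead2 (X : α × α → α × α → ℝ≥0∞) (b : α) :
    ∑' a, pkRow X (a, b) ≤ pkHead2 X :=
  le_iSup (fun b => ∑' a, pkRow X (a, b)) b

/-- `Σ_b col(X)(a,b) ≤ pkTail1 X`. [folklore] -/
theorem tsum_pkCol_le_pkTail1 (X : α × α → α × α → ℝ≥0∞) (a : α) :
    ∑' b, pkCol X (a, b) ≤ pkTail1 X :=
  le_iSup (fun a => ∑' b, pkCol X (a, b)) a

/-- `Σ_a col(X)(a,b) ≤ pkTail2 X`. [folklore] -/
theorem tsum_pkCol_le_pkTail2 (X : α × α → α × α → ℝ≥0∞) (b : α) :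
    ∑' a, pkCol X (a, b) ≤ pkTail2 X :=
  le_iSup (fun b => ∑' a, pkCol X (a, b)) b

/-- **Propagation of the head sum**: `pkHead1 (XY) ≤ pkHead1 X · ‖Y‖_{∞→∞}` — only the head has to
"close"; everything after it enters through its `ℓ^∞ → ℓ^∞` norm.
[cite: Hara2008, §3.5 (Case 2: "at least (N-3) factors of cλ")] -/
theorem pkHead1_pkMul_le (X Y : α × α → α × α → ℝ≥0∞) :
    pkHead1 (pkMul X Y) ≤ pkHead1 X * pkNormInf Y := by
  refine iSup_le fun a => ?_
  calc ∑' b, pkRow (pkMul X Y) (a, b) ≤ ∑' b, pkRow X (a, b) * pkNormInf Y :=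
        ENNReal.tsum_le_tsum fun b => pkRow_pkMul_le X Y (a, b)
    _ = (∑' b, pkRow X (a, b)) * pkNormInf Y := ENNReal.tsum_mul_right
    _ ≤ pkHead1 X * pkNormInf Y := mul_le_mul' (tsum_pkRow_le_pkHead1 X a) le_rfl

/-- `pkHead2 (XY) ≤ pkHead2 X · ‖Y‖_{∞→∞}`. [cite: Hara2008, §3.5 (Case 2)] -/
theorem pkHead2_pkMul_le (X Y : α × α → α × α → ℝ≥0∞) :
    pkHead2 (pkMul X Y) ≤ pkHead2 X * pkNormInf Y := by
  refine iSup_le fun b => ?_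
  calc ∑' a, pkRow (pkMul X Y) (a, b) ≤ ∑' a, pkRow X (a, b) * pkNormInf Y :=
        ENNReal.tsum_le_tsum fun a => pkRow_pkMul_le X Y (a, b)
    _ = (∑' a, pkRow X (a, b)) * pkNormInf Y := ENNReal.tsum_mul_right
    _ ≤ pkHead2 X * pkNormInf Y := mul_le_mul' (tsum_pkRow_le_pkHead2 X b) le_rfl

/-- **Propagation of the tail sum**: `pkTail1 (XY) ≤ ‖X‖_{1→1} · pkTail1 Y`.
[cite: Hara2008, §3.5 (Case 2)] -/
theorem pkTail1_pkMul_le (X Y : α × α → α × α → ℝ≥0∞) :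
    pkTail1 (pkMul X Y) ≤ pkNormOne X * pkTail1 Y := by
  refine iSup_le fun a => ?_
  calc ∑' b, pkCol (pkMul X Y) (a, b) ≤ ∑' b, pkNormOne X * pkCol Y (a, b) :=
        ENNReal.tsum_le_tsum fun b => pkCol_pkMul_le X Y (a, b)
    _ = pkNormOne X * ∑' b, pkCol Y (a, b) := ENNReal.tsum_mul_left
    _ ≤ pkNormOne X * pkTail1 Y := mul_le_mul' le_rfl (tsum_pkCol_le_pkTail1 Y a)

/-- `pkTail2 (XY) ≤ ‖X‖_{1→1} · pkTail2 Y`. [cite: Hara2008, §3.5 (Case 2)] -/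
theorem pkTail2_pkMul_le (X Y : α × α → α × α → ℝ≥0∞) :
    pkTail2 (pkMul X Y) ≤ pkNormOne X * pkTail2 Y := by
  refine iSup_le fun b => ?_
  calc ∑' a, pkCol (pkMul X Y) (a, b) ≤ ∑' a, pkNormOne X * pkCol Y (a, b) :=
        ENNReal.tsum_le_tsum fun a => pkCol_pkMul_le X Y (a, b)
    _ = pkNormOne X * ∑' a, pkCol Y (a, b) := ENNReal.tsum_mul_left
    _ ≤ pkNormOne X * pkTail2 Y := mul_le_mul' le_rfl (tsum_pkCol_le_pkTail2 Y b)

/-- Monotonicity of `pkHead1` in the kernel. [folklore] -/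
theorem pkHead1_mono {X Y : α × α → α × α → ℝ≥0∞} (h : ∀ p q, X p q ≤ Y p q) : pkHead1 X ≤ pkHead1 Y :=
  iSup_mono fun _ => ENNReal.tsum_le_tsum fun _ => pkRow_mono h _

/-- Monotonicity of `pkHead2` in the kernel. [folklore] -/
theorem pkHead2_mono {X Y : α × α → α × α → ℝ≥0∞} (h : ∀ p q, X p q ≤ Y p q) : pkHead2 X ≤ pkHead2 Y :=
  iSup_mono fun _ => ENNReal.tsum_le_tsum fun _ => pkRow_mono h _

/-- Monotonicity of `pkTail1` in the kernel. [folklore] -/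
theorem pkTail1_mono {X Y : α × α → α × α → ℝ≥0∞} (h : ∀ p q, X p q ≤ Y p q) : pkTail1 X ≤ pkTail1 Y :=
  iSup_mono fun _ => ENNReal.tsum_le_tsum fun _ => pkCol_mono h _

/-- Monotonicity of `pkTail2` in the kernel. [folklore] -/
theorem pkTail2_mono {X Y : α × α → α × α → ℝ≥0∞} (h : ∀ p q, X p q ≤ Y p q) : pkTail2 X ≤ pkTail2 Y :=
  iSup_mono fun _ => ENNReal.tsum_le_tsum fun _ => pkCol_mono h _

/-- Subadditivity of `pkHead1`. [folklore] -/
theorem pkHead1_add_le (X Y : α × α → α × α → ℝ≥0∞) :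
    pkHead1 (fun p q => X p q + Y p q) ≤ pkHead1 X + pkHead1 Y := by
  refine iSup_le fun a => ?_
  calc ∑' b, pkRow (fun p q => X p q + Y p q) (a, b) = ∑' b, (pkRow X (a, b) + pkRow Y (a, b)) :=
        tsum_congr fun b => pkRow_add X Y (a, b)
    _ = (∑' b, pkRow X (a, b)) + ∑' b, pkRow Y (a, b) := ENNReal.tsum_add
    _ ≤ pkHead1 X + pkHead1 Y := add_le_add (tsum_pkRow_le_pkHead1 X a) (tsum_pkRow_le_pkHead1 Y a)

/-- Subadditivity of `pkHead2`. [folklore] -/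
theorem pkHead2_add_le (X Y : α × α → α × α → ℝ≥0∞) :
    pkHead2 (fun p q => X p q + Y p q) ≤ pkHead2 X + pkHead2 Y := by
  refine iSup_le fun b => ?_
  calc ∑' a, pkRow (fun p q => X p q + Y p q) (a, b) = ∑' a, (pkRow X (a, b) + pkRow Y (a, b)) :=
        tsum_congr fun a => pkRow_add X Y (a, b)
    _ = (∑' a, pkRow X (a, b)) + ∑' a, pkRow Y (a, b) := ENNReal.tsum_add
    _ ≤ pkHead2 X + pkHead2 Y := add_le_add (tsum_pkRow_le_pkHead2 X b) (tsum_pkRow_le_pkHead2 Y b)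

/-- Subadditivity of `pkTail1`. [folklore] -/
theorem pkTail1_add_le (X Y : α × α → α × α → ℝ≥0∞) :
    pkTail1 (fun p q => X p q + Y p q) ≤ pkTail1 X + pkTail1 Y := by
  refine iSup_le fun a => ?_
  calc ∑' b, pkCol (fun p q => X p q + Y p q) (a, b) = ∑' b, (pkCol X (a, b) + pkCol Y (a, b)) :=
        tsum_congr fun b => pkCol_add X Y (a, b)
    _ = (∑' b, pkCol X (a, b)) + ∑' b, pkCol Y (a, b) := ENNReal.tsum_add
    _ ≤ pkTail1 X + pkTail1 Y := add_le_add (tsum_pkCol_le_pkTail1 X a) (tsum_pkCol_le_pkTail1 Y a)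

/-- Subadditivity of `pkTail2`. [folklore] -/
theorem pkTail2_add_le (X Y : α × α → α × α → ℝ≥0∞) :
    pkTail2 (fun p q => X p q + Y p q) ≤ pkTail2 X + pkTail2 Y := by
  refine iSup_le fun b => ?_
  calc ∑' a, pkCol (fun p q => X p q + Y p q) (a, b) = ∑' a, (pkCol X (a, b) + pkCol Y (a, b)) :=
        tsum_congr fun a => pkCol_add X Y (a, b)
    _ = (∑' a, pkCol X (a, b)) + ∑' a, pkCol Y (a, b) := ENNReal.tsum_add
    _ ≤ pkTail2 X + pkTail2 Y := add_le_add (tsum_pkCol_le_pkTail2 X b) (tsum_pkCol_le_pkTail2 Y b)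

/-- Monotonicity of the kernel product. [folklore] -/
theorem pkMul_mono {X X' Y Y' : α × α → α × α → ℝ≥0∞} (hX : ∀ p q, X p q ≤ X' p q)
    (hY : ∀ p q, Y p q ≤ Y' p q) (p q : α × α) : pkMul X Y p q ≤ pkMul X' Y' p q :=
  ENNReal.tsum_le_tsum fun _ => mul_le_mul' (hX _ _) (hY _ _)

/-- Monotonicity of `‖·‖_{∞→∞}`. [folklore] -/
theorem pkNormInf_mono {X Y : α × α → α × α → ℝ≥0∞} (h : ∀ p q, X p q ≤ Y p q) :
    pkNormInf X ≤ pkNormInf Y :=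
  iSup_mono fun _ => ENNReal.tsum_le_tsum fun _ => h _ _

/-- Monotonicity of `‖·‖_{1→1}`. [folklore] -/
theorem pkNormOne_mono {X Y : α × α → α × α → ℝ≥0∞} (h : ∀ p q, X p q ≤ Y p q) :
    pkNormOne X ≤ pkNormOne Y :=
  iSup_mono fun _ => ENNReal.tsum_le_tsum fun _ => h _ _

/-- Scaling a kernel by a constant scales `‖·‖_{∞→∞}`. [folklore] -/
theorem pkNormInf_const_mul (c : ℝ≥0∞) (X : α × α → α × α → ℝ≥0∞) :
    pkNormInf (fun p q => c * X p q) = c * pkNormInf X := by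
  rw [pkNormInf, pkNormInf, ENNReal.mul_iSup]
  exact iSup_congr fun p => ENNReal.tsum_mul_left

/-- Scaling a kernel by a constant scales `‖·‖_{1→1}`. [folklore] -/
theorem pkNormOne_const_mul (c : ℝ≥0∞) (X : α × α → α × α → ℝ≥0∞) :
    pkNormOne (fun p q => c * X p q) = c * pkNormOne X := by
  rw [pkNormOne, pkNormOne, ENNReal.mul_iSup]
  exact iSup_congr fun p => ENNReal.tsum_mul_left

/-- Scaling a kernel by a constant scales `pkHead1`. [folklore] -/
theorem pkHead1_const_mul (c : ℝ≥0∞) (X : α × α → α × α → ℝ≥0∞) :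
    pkHead1 (fun p q => c * X p q) = c * pkHead1 X := by
  rw [pkHead1, pkHead1, ENNReal.mul_iSup]
  refine iSup_congr fun a => ?_
  rw [← ENNReal.tsum_mul_left]
  exact tsum_congr fun b => ENNReal.tsum_mul_left

/-- Scaling a kernel by a constant scales `pkHead2`. [folklore] -/
theorem pkHead2_const_mul (c : ℝ≥0∞) (X : α × α → α × α → ℝ≥0∞) :
    pkHead2 (fun p q => c * X p q) = c * pkHead2 X := by
  rw [pkHead2, pkHead2, ENNReal.mul_iSup]
  refine iSup_congr fun b => ?_
  rw [← ENNReal.tsum_mul_left]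
  exact tsum_congr fun a => ENNReal.tsum_mul_left

/-- Scaling a kernel by a constant scales `pkTail1`. [folklore] -/
theorem pkTail1_const_mul (c : ℝ≥0∞) (X : α × α → α × α → ℝ≥0∞) :
    pkTail1 (fun p q => c * X p q) = c * pkTail1 X := by
  rw [pkTail1, pkTail1, ENNReal.mul_iSup]
  refine iSup_congr fun a => ?_
  rw [← ENNReal.tsum_mul_left]
  exact tsum_congr fun b => ENNReal.tsum_mul_left

/-- Scaling a kernel by a constant scales `pkTail2`. [folklore] -/
theorem pkTail2_const_mul (c : ℝ≥0∞) (X : α × α → α × α → ℝ≥0∞) :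
    pkTail2 (fun p q => c * X p q) = c * pkTail2 X := by
  rw [pkTail2, pkTail2, ENNReal.mul_iSup]
  refine iSup_congr fun b => ?_
  rw [← ENNReal.tsum_mul_left]
  exact tsum_congr fun a => ENNReal.tsum_mul_left

/-! ### The Cauchy–Schwarz bound for the middle factor -/

/-- **Cauchy–Schwarz with the middle kernel as weight**:
`(Σ_P Σ_Q F(P) U(P,Q) G(Q))² ≤ (Σ_P F(P)² row(U)(P)) · (Σ_Q col(U)(Q) G(Q)²)`
(write `F U G = (F √U)(√U G)` on the product index set). This replaces Hara's Schwarz inequality on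
the doubled ladder (Fig. 5 (d-1)): the two factors are a SINGLE copy of the middle kernel `U`
closed by two copies of the entry line, resp. of the exit line.
[cite: Hara2008, §3.5 (Case 2: "(d-1) is bounded by the Schwarz inequality")] -/
theorem tsum_mul_mul_sq_le (F G : α × α → ℝ≥0∞) (U : α × α → α × α → ℝ≥0∞) :
    (∑' P, ∑' Q, F P * U P Q * G Q) ^ 2 ≤ (∑' P, F P ^ 2 * pkRow U P) * ∑' Q, pkCol U Q * G Q ^ 2 := by
  -- pass to the product index set and apply Cauchy–Schwarz there
  have h1 : ∑' P, ∑' Q, F P * U P Q * G Q = ∑' PQ : (α × α) × (α × α),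
      (F PQ.1 * U PQ.1 PQ.2 ^ (2⁻¹ : ℝ)) * (U PQ.1 PQ.2 ^ (2⁻¹ : ℝ) * G PQ.2) := by
    rw [← ENNReal.tsum_prod (f := fun P Q => F P * U P Q * G Q)]
    refine tsum_congr fun PQ => ?_
    have hU : U PQ.1 PQ.2 = U PQ.1 PQ.2 ^ (2⁻¹ : ℝ) * U PQ.1 PQ.2 ^ (2⁻¹ : ℝ) := by
      rw [← ENNReal.rpow_add_of_nonneg _ _ (by norm_num) (by norm_num),
        show (2⁻¹ : ℝ) + 2⁻¹ = 1 by norm_num, ENNReal.rpow_one]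
    calc F PQ.1 * U PQ.1 PQ.2 * G PQ.2
        = F PQ.1 * (U PQ.1 PQ.2 ^ (2⁻¹ : ℝ) * U PQ.1 PQ.2 ^ (2⁻¹ : ℝ)) * G PQ.2 := by rw [← hU]
      _ = _ := by ring
  have hsq : ∀ u : ℝ≥0∞, (u ^ (2⁻¹ : ℝ)) ^ 2 = u := fun u =>
    ENNReal.rpow_inv_natCast_pow two_ne_zero u
  rw [h1]
  refine (ennreal_sq_tsum_mul_le _ _).trans (le_of_eq ?_)
  congr 1
  · rw [ENNReal.tsum_prod']
    refine tsum_congr fun P => ?_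
    rw [pkRow, ← ENNReal.tsum_mul_left]
    exact tsum_congr fun Q => by rw [mul_pow, hsq]
  · rw [ENNReal.tsum_prod', ENNReal.tsum_comm]
    refine tsum_congr fun Q => ?_
    rw [pkCol, ← ENNReal.tsum_mul_right]
    exact tsum_congr fun P => by rw [mul_pow, hsq]

/-- **The entry closes on the head sum**: if the entry structure is dominated by a function of the
ENTERED coordinate 1, `F(P) ≤ f(P.1) · c`, then `Σ_P F(P)² row(U)(P) ≤ (c² Σ_a f(a)²) · pkHead1 U`.
[cite: Hara2008, §3.5 (Case 2)] -/
theorem tsum_sq_mul_pkRow_le_pkHead1 {F : α × α → ℝ≥0∞} {f : α → ℝ≥0∞} {c : ℝ≥0∞}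
    (U : α × α → α × α → ℝ≥0∞) (hF : ∀ P, F P ≤ f P.1 * c) :
    ∑' P, F P ^ 2 * pkRow U P ≤ c ^ 2 * (∑' a, f a ^ 2) * pkHead1 U := by
  calc ∑' P, F P ^ 2 * pkRow U P ≤ ∑' P : α × α, (f P.1 * c) ^ 2 * pkRow U P :=
        ENNReal.tsum_le_tsum fun P => mul_le_mul' (pow_le_pow_left' (hF P) 2) le_rfl
    _ = ∑' a, ∑' b, (f a * c) ^ 2 * pkRow U (a, b) := ENNReal.tsum_prod'
    _ = ∑' a, (f a * c) ^ 2 * ∑' b, pkRow U (a, b) := tsum_congr fun a => ENNReal.tsum_mul_left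
    _ ≤ ∑' a, (f a * c) ^ 2 * pkHead1 U :=
        ENNReal.tsum_le_tsum fun a => mul_le_mul' le_rfl (tsum_pkRow_le_pkHead1 U a)
    _ = c ^ 2 * (∑' a, f a ^ 2) * pkHead1 U := by
        rw [ENNReal.tsum_mul_right, ← ENNReal.tsum_mul_left]
        congr 1
        exact tsum_congr fun a => by ring

/-- The same with the entry on coordinate 2: `F(P) ≤ f(P.2) · c` gives
`Σ_P F(P)² row(U)(P) ≤ (c² Σ_b f(b)²) · pkHead2 U`. [cite: Hara2008, §3.5 (Case 2)] -/
theorem tsum_sq_mul_pkRow_le_pkHead2 {F : α × α → ℝ≥0∞} {f : α → ℝ≥0∞} {c : ℝ≥0∞}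
    (U : α × α → α × α → ℝ≥0∞) (hF : ∀ P, F P ≤ f P.2 * c) :
    ∑' P, F P ^ 2 * pkRow U P ≤ c ^ 2 * (∑' b, f b ^ 2) * pkHead2 U := by
  calc ∑' P, F P ^ 2 * pkRow U P ≤ ∑' P : α × α, (f P.2 * c) ^ 2 * pkRow U P :=
        ENNReal.tsum_le_tsum fun P => mul_le_mul' (pow_le_pow_left' (hF P) 2) le_rfl
    _ = ∑' a, ∑' b, (f b * c) ^ 2 * pkRow U (a, b) := ENNReal.tsum_prod'
    _ = ∑' b, ∑' a, (f b * c) ^ 2 * pkRow U (a, b) := ENNReal.tsum_comm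
    _ = ∑' b, (f b * c) ^ 2 * ∑' a, pkRow U (a, b) := tsum_congr fun b => ENNReal.tsum_mul_left
    _ ≤ ∑' b, (f b * c) ^ 2 * pkHead2 U :=
        ENNReal.tsum_le_tsum fun b => mul_le_mul' le_rfl (tsum_pkRow_le_pkHead2 U b)
    _ = c ^ 2 * (∑' b, f b ^ 2) * pkHead2 U := by
        rw [ENNReal.tsum_mul_right, ← ENNReal.tsum_mul_left]
        congr 1
        exact tsum_congr fun b => by ring

/-- **The exit closes on the tail sum** (coordinate 1): `G(Q) ≤ g(Q.1) · c` gives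
`Σ_Q col(U)(Q) G(Q)² ≤ (c² Σ_a g(a)²) · pkTail1 U`. [cite: Hara2008, §3.5 (Case 2)] -/
theorem tsum_pkCol_mul_sq_le_pkTail1 {G : α × α → ℝ≥0∞} {g : α → ℝ≥0∞} {c : ℝ≥0∞}
    (U : α × α → α × α → ℝ≥0∞) (hG : ∀ Q, G Q ≤ g Q.1 * c) :
    ∑' Q, pkCol U Q * G Q ^ 2 ≤ c ^ 2 * (∑' a, g a ^ 2) * pkTail1 U := by
  calc ∑' Q, pkCol U Q * G Q ^ 2 ≤ ∑' Q : α × α, pkCol U Q * (g Q.1 * c) ^ 2 :=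
        ENNReal.tsum_le_tsum fun Q => mul_le_mul' le_rfl (pow_le_pow_left' (hG Q) 2)
    _ = ∑' a, ∑' b, pkCol U (a, b) * (g a * c) ^ 2 := ENNReal.tsum_prod'
    _ = ∑' a, (∑' b, pkCol U (a, b)) * (g a * c) ^ 2 := tsum_congr fun a => ENNReal.tsum_mul_right
    _ ≤ ∑' a, pkTail1 U * (g a * c) ^ 2 :=
        ENNReal.tsum_le_tsum fun a => mul_le_mul' (tsum_pkCol_le_pkTail1 U a) le_rfl
    _ = c ^ 2 * (∑' a, g a ^ 2) * pkTail1 U := by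
        rw [ENNReal.tsum_mul_left, show (∑' a, (g a * c) ^ 2) = c ^ 2 * ∑' a, g a ^ 2 by
          rw [← ENNReal.tsum_mul_left]; exact tsum_congr fun a => by ring]
        ring

/-- The exit closes on the tail sum (coordinate 2): `G(Q) ≤ g(Q.2) · c` gives
`Σ_Q col(U)(Q) G(Q)² ≤ (c² Σ_b g(b)²) · pkTail2 U`. [cite: Hara2008, §3.5 (Case 2)] -/
theorem tsum_pkCol_mul_sq_le_pkTail2 {G : α × α → ℝ≥0∞} {g : α → ℝ≥0∞} {c : ℝ≥0∞}
    (U : α × α → α × α → ℝ≥0∞) (hG : ∀ Q, G Q ≤ g Q.2 * c) :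
    ∑' Q, pkCol U Q * G Q ^ 2 ≤ c ^ 2 * (∑' b, g b ^ 2) * pkTail2 U := by
  calc ∑' Q, pkCol U Q * G Q ^ 2 ≤ ∑' Q : α × α, pkCol U Q * (g Q.2 * c) ^ 2 :=
        ENNReal.tsum_le_tsum fun Q => mul_le_mul' le_rfl (pow_le_pow_left' (hG Q) 2)
    _ = ∑' a, ∑' b, pkCol U (a, b) * (g b * c) ^ 2 := ENNReal.tsum_prod'
    _ = ∑' b, ∑' a, pkCol U (a, b) * (g b * c) ^ 2 := ENNReal.tsum_comm
    _ = ∑' b, (∑' a, pkCol U (a, b)) * (g b * c) ^ 2 := tsum_congr fun b => ENNReal.tsum_mul_right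
    _ ≤ ∑' b, pkTail2 U * (g b * c) ^ 2 :=
        ENNReal.tsum_le_tsum fun b => mul_le_mul' (tsum_pkCol_le_pkTail2 U b) le_rfl
    _ = c ^ 2 * (∑' b, g b ^ 2) * pkTail2 U := by
        rw [ENNReal.tsum_mul_left, show (∑' b, (g b * c) ^ 2) = c ^ 2 * ∑' b, g b ^ 2 by
          rw [← ENNReal.tsum_mul_left]; exact tsum_congr fun b => by ring]
        ring

/-- **The middle factor, squared**: with an entry dominated on its entered coordinate and an exit
dominated on its exit coordinate (here both coordinate 1; the eight combinations follow by
combining the four lemmas above with `tsum_mul_mul_sq_le`),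
`(Σ_{P,Q} F(P) U(P,Q) G(Q))² ≤ (c_F² Σf²) pkHead1 U · ((c_G² Σg²) pkTail1 U)`.
[cite: Hara2008, §3.5 (Case 2, (d-1)–(d-2))] -/
theorem middle_sq_le_pkHead1_pkTail1 {F G : α × α → ℝ≥0∞} {f g : α → ℝ≥0∞} {cF cG : ℝ≥0∞}
    (U : α × α → α × α → ℝ≥0∞) (hF : ∀ P, F P ≤ f P.1 * cF) (hG : ∀ Q, G Q ≤ g Q.1 * cG) :
    (∑' P, ∑' Q, F P * U P Q * G Q) ^ 2 ≤
      (cF ^ 2 * (∑' a, f a ^ 2) * pkHead1 U) * (cG ^ 2 * (∑' a, g a ^ 2) * pkTail1 U) :=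
  (tsum_mul_mul_sq_le F G U).trans
    (mul_le_mul' (tsum_sq_mul_pkRow_le_pkHead1 U hF) (tsum_pkCol_mul_sq_le_pkTail1 U hG))

/-- The middle factor itself: `Σ_{P,Q} F U G ≤ (A · B)^{1/2}` whenever
`Σ_P F² row(U) ≤ A` and `Σ_Q col(U) G² ≤ B`. [cite: Hara2008, §3.5 (Case 2, (d-1))] -/
theorem middle_le_rpow_half {F G : α × α → ℝ≥0∞} (U : α × α → α × α → ℝ≥0∞) {A B : ℝ≥0∞}
    (hA : ∑' P, F P ^ 2 * pkRow U P ≤ A) (hB : ∑' Q, pkCol U Q * G Q ^ 2 ≤ B) :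
    ∑' P, ∑' Q, F P * U P Q * G Q ≤ (A * B) ^ (2⁻¹ : ℝ) :=
  ennreal_le_rpow_half_of_sq_le ((tsum_mul_mul_sq_le F G U).trans (mul_le_mul' hA hB))

/-! ### The three-factor estimate with a uniformly bounded middle kernel -/

/-- `Σ_p Σ_q v(p) M(p,q) r(q) ≤ (Σ v) · s · (Σ r)` whenever `M ≤ s` pointwise ("the left and the right
components which can be easily decomposed into triangles", times the bound on the middle factor).
[cite: Hara2008, §3.5 (Case 2: the decomposition (c-4)–(c-7))] -/
theorem tsum_tsum_mul_mul_le_of_le (v : α × α → ℝ≥0∞) (M : α × α → α × α → ℝ≥0∞)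
    (r : α × α → ℝ≥0∞) {s : ℝ≥0∞} (hM : ∀ p q, M p q ≤ s) :
    ∑' p, ∑' q, v p * M p q * r q ≤ (∑' p, v p) * s * ∑' q, r q := by
  calc ∑' p, ∑' q, v p * M p q * r q ≤ ∑' p, ∑' q, v p * s * r q :=
        ENNReal.tsum_le_tsum fun p => ENNReal.tsum_le_tsum fun q =>
          mul_le_mul' (mul_le_mul' le_rfl (hM p q)) le_rfl
    _ = ∑' p, v p * s * ∑' q, r q := tsum_congr fun p => ENNReal.tsum_mul_left
    _ = (∑' p, v p) * s * ∑' q, r q := by rw [ENNReal.tsum_mul_right, ENNReal.tsum_mul_right]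

/-- **Three factors along a chain, `sup`-bounded middle**: for a chain `v L₁⋯L_k M R₁⋯R_n` closed by
`e`, `Σ_p (v L₁⋯L_k M R₁⋯R_n)(p) e(p) ≤ (Σ_p (v L₁⋯L_k)(p)) · s · Σ_q (R₁⋯R_n e)(q)` if `M ≤ s`.
[cite: Hara2008, §3.5 (Case 2)] -/
theorem tsum_pkChainL_middle_le (v : α × α → ℝ≥0∞) (L R : List (α × α → α × α → ℝ≥0∞))
    (M : α × α → α × α → ℝ≥0∞) (e : α × α → ℝ≥0∞) {s : ℝ≥0∞} (hM : ∀ p q, M p q ≤ s) :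
    ∑' p, pkChainL v (L ++ M :: R) p * e p ≤
      (∑' p, pkChainL v L p) * s * ∑' q, pkChainR R e q := by
  rw [pkChainL_append, tsum_pkChainL_mul, pkChainR_cons]
  calc ∑' p, pkChainL v L p * pkKvec M (pkChainR R e) p
      = ∑' p, ∑' q, pkChainL v L p * M p q * pkChainR R e q := by
        refine tsum_congr fun p => ?_
        rw [pkKvec, ← ENNReal.tsum_mul_left]
        exact tsum_congr fun q => (mul_assoc _ _ _).symm
    _ ≤ _ := tsum_tsum_mul_mul_le_of_le _ _ _ hM

/-- **Plain `ℓ¹` bound for right chains**: `Σ_q (X₁ ⋯ X_n f)(q) ≤ (Π ‖X_i‖_{1→1}) Σ_q f(q)` (no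
translation invariance needed). [cite: HeydenreichVanDerHofstad2017, Exercise 7.5] -/
theorem tsum_pkChainR_le (Xs : List (α × α → α × α → ℝ≥0∞)) (f : α × α → ℝ≥0∞) :
    ∑' q, pkChainR Xs f q ≤ (Xs.map pkNormOne).prod * ∑' q, f q := by
  induction Xs with
  | nil => simp
  | cons X Xs ih =>
    calc ∑' q, pkChainR (X :: Xs) f q = ∑' q, pkKvec X (pkChainR Xs f) q := rfl
      _ ≤ pkNormOne X * ∑' q, pkChainR Xs f q := tsum_pkKvec_le X _
      _ ≤ pkNormOne X * ((Xs.map pkNormOne).prod * ∑' q, f q) := mul_le_mul' le_rfl ih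
      _ = ((X :: Xs).map pkNormOne).prod * ∑' q, f q := by
          rw [List.map_cons, List.prod_cons, mul_assoc]

/-- `‖X₁ ⋯ X_n‖_{∞→∞}`-bound for the row sums of a product, as a list:
`row(M₀ M₁ ⋯ M_m)(p) ≤ row(M₀)(p) Π ‖M_i‖_{∞→∞}`. [folklore] -/
theorem pkRow_pkProd_le (M : α × α → α × α → ℝ≥0∞) (Ms : List (α × α → α × α → ℝ≥0∞)) (p : α × α) :
    pkRow (pkProd M Ms) p ≤ pkRow M p * (Ms.map pkNormInf).prod := by
  induction Ms generalizing M with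
  | nil => simp
  | cons M' Ms ih =>
    calc pkRow (pkProd M (M' :: Ms)) p = pkRow (pkMul M (pkProd M' Ms)) p := rfl
      _ ≤ pkRow M p * pkNormInf (pkProd M' Ms) := pkRow_pkMul_le _ _ _
      _ ≤ pkRow M p * (pkNormInf M' * (Ms.map pkNormInf).prod) :=
          mul_le_mul' le_rfl (pkNormInf_pkProd_le M' Ms)
      _ = pkRow M p * ((M' :: Ms).map pkNormInf).prod := by rw [List.map_cons, List.prod_cons]

/-! ### Transposition and coordinate swap -/

/-- The transposed kernel `Xᵀ(p, q) = X(q, p)`. [folklore] -/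
def pkT (X : α × α → α × α → ℝ≥0∞) (p q : α × α) : ℝ≥0∞ := X q p

/-- The coordinate-swapped kernel `Xˢ((a,b),(c,d)) = X((b,a),(d,c))`. [folklore] -/
def pkSw (X : α × α → α × α → ℝ≥0∞) (p q : α × α) : ℝ≥0∞ := X p.swap q.swap

/-- Unfolding of the transpose. [folklore] -/
@[simp] theorem pkT_apply (X : α × α → α × α → ℝ≥0∞) (p q : α × α) : pkT X p q = X q p := rfl

/-- Unfolding of the swap. [folklore] -/
@[simp] theorem pkSw_apply (X : α × α → α × α → ℝ≥0∞) (p q : α × α) : pkSw X p q = X p.swap q.swap := rfl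

/-- Transposition is an involution. [folklore] -/
@[simp] theorem pkT_pkT (X : α × α → α × α → ℝ≥0∞) : pkT (pkT X) = X := rfl

/-- The swap is an involution. [folklore] -/
@[simp] theorem pkSw_pkSw (X : α × α → α × α → ℝ≥0∞) : pkSw (pkSw X) = X := by
  funext p q; simp [pkSw]

/-- `col(X) = row(Xᵀ)`. [folklore] -/
theorem pkCol_eq_pkRow_pkT (X : α × α → α × α → ℝ≥0∞) (q : α × α) : pkCol X q = pkRow (pkT X) q := rfl

/-- `row(X) = col(Xᵀ)`. [folklore] -/
theorem pkRow_eq_pkCol_pkT (X : α × α → α × α → ℝ≥0∞) (p : α × α) : pkRow X p = pkCol (pkT X) p := rfl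

/-- `‖X‖_{1→1} = ‖Xᵀ‖_{∞→∞}`. [folklore] -/
theorem pkNormOne_eq_pkNormInf_pkT (X : α × α → α × α → ℝ≥0∞) : pkNormOne X = pkNormInf (pkT X) := rfl

/-- `‖X‖_{∞→∞} = ‖Xᵀ‖_{1→1}`. [folklore] -/
theorem pkNormInf_eq_pkNormOne_pkT (X : α × α → α × α → ℝ≥0∞) : pkNormInf X = pkNormOne (pkT X) := rfl

/-- **Tails are heads of the transpose** (coordinate 1). [folklore] -/
theorem pkTail1_eq_pkHead1_pkT (X : α × α → α × α → ℝ≥0∞) : pkTail1 X = pkHead1 (pkT X) := rfl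

/-- Tails are heads of the transpose (coordinate 2). [folklore] -/
theorem pkTail2_eq_pkHead2_pkT (X : α × α → α × α → ℝ≥0∞) : pkTail2 X = pkHead2 (pkT X) := rfl

/-- Heads are tails of the transpose (coordinate 1). [folklore] -/
theorem pkHead1_eq_pkTail1_pkT (X : α × α → α × α → ℝ≥0∞) : pkHead1 X = pkTail1 (pkT X) := rfl

/-- Heads are tails of the transpose (coordinate 2). [folklore] -/
theorem pkHead2_eq_pkTail2_pkT (X : α × α → α × α → ℝ≥0∞) : pkHead2 X = pkTail2 (pkT X) := rfl

/-- Transposition reverses products: `(XY)ᵀ = Yᵀ Xᵀ`. [folklore] -/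
theorem pkT_pkMul (X Y : α × α → α × α → ℝ≥0∞) : pkT (pkMul X Y) = pkMul (pkT Y) (pkT X) := by
  funext p q
  simp only [pkT, pkMul]
  exact tsum_congr fun m => mul_comm _ _

/-- Row sums of the swapped kernel. [folklore] -/
theorem pkRow_pkSw (X : α × α → α × α → ℝ≥0∞) (p : α × α) : pkRow (pkSw X) p = pkRow X p.swap := by
  rw [pkRow, pkRow, ← (Equiv.prodComm α α).tsum_eq (fun q => X p.swap q)]
  rfl

/-- Column sums of the swapped kernel. [folklore] -/
theorem pkCol_pkSw (X : α × α → α × α → ℝ≥0∞) (q : α × α) : pkCol (pkSw X) q = pkCol X q.swap := by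
  rw [pkCol, pkCol, ← (Equiv.prodComm α α).tsum_eq (fun p => X p q.swap)]
  rfl

/-- `‖Xˢ‖_{∞→∞} = ‖X‖_{∞→∞}`. [folklore] -/
theorem pkNormInf_pkSw (X : α × α → α × α → ℝ≥0∞) : pkNormInf (pkSw X) = pkNormInf X := by
  rw [pkNormInf_eq_iSup_pkRow, pkNormInf_eq_iSup_pkRow,
    ← (Equiv.prodComm α α).iSup_congr (g := fun p => pkRow X p) (fun p => ?_)]
  exact (pkRow_pkSw X p).symm

/-- `‖Xˢ‖_{1→1} = ‖X‖_{1→1}`. [folklore] -/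
theorem pkNormOne_pkSw (X : α × α → α × α → ℝ≥0∞) : pkNormOne (pkSw X) = pkNormOne X := by
  rw [pkNormOne_eq_iSup_pkCol, pkNormOne_eq_iSup_pkCol,
    ← (Equiv.prodComm α α).iSup_congr (g := fun q => pkCol X q) (fun q => ?_)]
  exact (pkCol_pkSw X q).symm

/-- **Swapping the coordinates exchanges the two heads**: `pkHead1 Xˢ = pkHead2 X`. [folklore] -/
theorem pkHead1_pkSw (X : α × α → α × α → ℝ≥0∞) : pkHead1 (pkSw X) = pkHead2 X := by
  simp only [pkHead1, pkHead2, pkRow_pkSw, Prod.swap_prod_mk]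

/-- `pkHead2 Xˢ = pkHead1 X`. [folklore] -/
theorem pkHead2_pkSw (X : α × α → α × α → ℝ≥0∞) : pkHead2 (pkSw X) = pkHead1 X := by
  simp only [pkHead1, pkHead2, pkRow_pkSw, Prod.swap_prod_mk]

/-- `pkTail1 Xˢ = pkTail2 X`. [folklore] -/
theorem pkTail1_pkSw (X : α × α → α × α → ℝ≥0∞) : pkTail1 (pkSw X) = pkTail2 X := by
  simp only [pkTail1, pkTail2, pkCol_pkSw, Prod.swap_prod_mk]

/-- `pkTail2 Xˢ = pkTail1 X`. [folklore] -/
theorem pkTail2_pkSw (X : α × α → α × α → ℝ≥0∞) : pkTail2 (pkSw X) = pkTail1 X := by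
  simp only [pkTail1, pkTail2, pkCol_pkSw, Prod.swap_prod_mk]

/-- Swap is multiplicative: `(XY)ˢ = Xˢ Yˢ`. [folklore] -/
theorem pkSw_pkMul (X Y : α × α → α × α → ℝ≥0∞) : pkSw (pkMul X Y) = pkMul (pkSw X) (pkSw Y) := by
  funext p q
  simp only [pkSw, pkMul]
  rw [← (Equiv.prodComm α α).tsum_eq (fun m => X p.swap m * Y m q.swap)]
  rfl

/-- Swap commutes with transposition. [folklore] -/
theorem pkSw_pkT (X : α × α → α × α → ℝ≥0∞) : pkSw (pkT X) = pkT (pkSw X) := rfl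

/-! ### Rungs attached to a kernel -/

/-- A kernel with a weight on its input pair: `(ρ·X)(p, q) = ρ(p) X(p, q)` (a rung `ρ` tying the
input pair, then `X`). [folklore] -/
def pkScaleL (ρ : α × α → ℝ≥0∞) (X : α × α → α × α → ℝ≥0∞) (p q : α × α) : ℝ≥0∞ := ρ p * X p q

/-- A kernel with a weight on its output pair: `(X·ρ)(p, q) = X(p, q) ρ(q)`. [folklore] -/
def pkScaleR (X : α × α → α × α → ℝ≥0∞) (ρ : α × α → ℝ≥0∞) (p q : α × α) : ℝ≥0∞ := X p q * ρ q

/-- Unfolding of `pkScaleL`. [folklore] -/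
@[simp] theorem pkScaleL_apply (ρ : α × α → ℝ≥0∞) (X : α × α → α × α → ℝ≥0∞) (p q : α × α) :
    pkScaleL ρ X p q = ρ p * X p q := rfl

/-- Unfolding of `pkScaleR`. [folklore] -/
@[simp] theorem pkScaleR_apply (X : α × α → α × α → ℝ≥0∞) (ρ : α × α → ℝ≥0∞) (p q : α × α) :
    pkScaleR X ρ p q = X p q * ρ q := rfl

/-- Moving a rung across a product: `(X·ρ) Y = X (ρ·Y)`. [folklore] -/
theorem pkMul_pkScaleR (X Y : α × α → α × α → ℝ≥0∞) (ρ : α × α → ℝ≥0∞) :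
    pkMul (pkScaleR X ρ) Y = pkMul X (pkScaleL ρ Y) := by
  funext p q
  simp only [pkMul, pkScaleR, pkScaleL, mul_assoc]

/-- A rung on the input of a product sits on its first factor: `ρ·(XY) = (ρ·X) Y`. [folklore] -/
theorem pkScaleL_pkMul (ρ : α × α → ℝ≥0∞) (X Y : α × α → α × α → ℝ≥0∞) :
    pkScaleL ρ (pkMul X Y) = pkMul (pkScaleL ρ X) Y := by
  funext p q
  simp only [pkMul, pkScaleL, ← ENNReal.tsum_mul_left, mul_assoc]

/-- A rung on the output of a product sits on its last factor: `(XY)·ρ = X (Y·ρ)`. [folklore] -/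
theorem pkScaleR_pkMul (X Y : α × α → α × α → ℝ≥0∞) (ρ : α × α → ℝ≥0∞) :
    pkScaleR (pkMul X Y) ρ = pkMul X (pkScaleR Y ρ) := by
  funext p q
  simp only [pkMul, pkScaleR, ← ENNReal.tsum_mul_right, mul_assoc]

/-- A row vector absorbs a rung on the input of the next kernel: `v (ρ·X) = (vρ) X`. [folklore] -/
theorem pkVmul_pkScaleL (v ρ : α × α → ℝ≥0∞) (X : α × α → α × α → ℝ≥0∞) :
    pkVmul v (pkScaleL ρ X) = pkVmul (fun p => v p * ρ p) X := by
  funext q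
  simp only [pkVmul, pkScaleL, mul_assoc]

/-- A column vector absorbs a rung on the output of the previous kernel: `(X·ρ) f = X (ρf)`. [folklore] -/
theorem pkKvec_pkScaleR (X : α × α → α × α → ℝ≥0∞) (ρ f : α × α → ℝ≥0∞) :
    pkKvec (pkScaleR X ρ) f = pkKvec X (fun q => ρ q * f q) := by
  funext p
  simp only [pkKvec, pkScaleR, mul_assoc]

/-- Transpose of a left-scaled kernel. [folklore] -/
theorem pkT_pkScaleL (ρ : α × α → ℝ≥0∞) (X : α × α → α × α → ℝ≥0∞) :
    pkT (pkScaleL ρ X) = pkScaleR (pkT X) ρ := by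
  funext p q
  simp [pkScaleL, pkScaleR, mul_comm]

/-- Transpose of a right-scaled kernel. [folklore] -/
theorem pkT_pkScaleR (X : α × α → α × α → ℝ≥0∞) (ρ : α × α → ℝ≥0∞) :
    pkT (pkScaleR X ρ) = pkScaleL ρ (pkT X) := by
  funext p q
  simp [pkScaleL, pkScaleR, mul_comm]

/-- Swap of a left-scaled kernel. [folklore] -/
theorem pkSw_pkScaleL (ρ : α × α → ℝ≥0∞) (X : α × α → α × α → ℝ≥0∞) :
    pkSw (pkScaleL ρ X) = pkScaleL (fun p => ρ p.swap) (pkSw X) := rfl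

/-- Swap of a right-scaled kernel. [folklore] -/
theorem pkSw_pkScaleR (X : α × α → α × α → ℝ≥0∞) (ρ : α × α → ℝ≥0∞) :
    pkSw (pkScaleR X ρ) = pkScaleR (pkSw X) (fun q => ρ q.swap) := rfl

/-- With a bounded weight `ρ ≤ c` on the input, `‖ρ·X‖_{1→1} ≤ c ‖X‖_{1→1}`. [folklore] -/
theorem pkNormOne_pkScaleL_le {ρ : α × α → ℝ≥0∞} {c : ℝ≥0∞} (hρ : ∀ p, ρ p ≤ c)
    (X : α × α → α × α → ℝ≥0∞) : pkNormOne (pkScaleL ρ X) ≤ c * pkNormOne X := by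
  rw [← pkNormOne_const_mul]
  exact pkNormOne_mono fun p q => mul_le_mul' (hρ p) le_rfl

/-- With a bounded weight `ρ ≤ c` on the output, `‖X·ρ‖_{∞→∞} ≤ c ‖X‖_{∞→∞}`. [folklore] -/
theorem pkNormInf_pkScaleR_le {ρ : α × α → ℝ≥0∞} {c : ℝ≥0∞} (hρ : ∀ q, ρ q ≤ c)
    (X : α × α → α × α → ℝ≥0∞) : pkNormInf (pkScaleR X ρ) ≤ c * pkNormInf X := by
  rw [← pkNormInf_const_mul]
  exact pkNormInf_mono fun p q => by rw [pkScaleR_apply, mul_comm c]; exact mul_le_mul' le_rfl (hρ q)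

end Literature.Barriers.CriticalPhenomena
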